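import Literature.AlgebraicGeometry.HodgeTheory.FermatFourfoldFiveStandardSextuples
import Literature.AlgebraicGeometry.HodgeTheory.FermatSurfaceHodgeCharacterStructureProofs
import HarnessLib

/-!
# Hodge sextuples at a level prime to `6`: four points of a `5`-progression force Aoki's `σ_{5,A}` — stub S16-L3 `stub_sigmaFive_of_fibre` of line `cancel-by-any-claim-lattice`, crux `HodgeFermatVarieties` (stmt-HodgeConjecture-1334)

Crux `HodgeFermatVarieties` (stmt-HodgeConjecture-1334), line `cancel-by-any-claim-lattice`, stub S16-L3
`stub_sigmaFive_of_fibre` (worker file). Everything here is PROVED (no `sorry`, no new definition, no new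
named fact).

The lead's programme S16 classifies the Hodge SEXTUPLES `s` of `ℤ/m`, `(m, 6) = 1`: three pairs, or Aoki's
standard element `σ_{5,A} = {A + j·e : j < 5} + {-5A}`, `e = m/5`, `5A ≠ 0`. A level analysis (stub S16-L2)
produces four of the five progression points `A + j e` inside `s`; THIS file finishes:

* `stub_sigmaFive_of_fibre` (registered signature): if a Hodge sextuple `s` of level `m` coprime to `6`,
  `5 ∣ m`, contains the points `A + j(m/5)`, `j < 5`, `j ≠ j₀` (`5A ≠ 0`), then `s` is three pairs or
  `s = {A + j(m/5) : j < 5} + {-5A}` (in fact always the latter).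

Proof. The standard multiset `σ = {A + j e : j < 5} + {-5A}` is a Hodge multiset
(`isHodgeMultiset_pStandard`, Aoki 1983 Prop. 5.1 with `p = 5 = 2·2+1`), hence so is its negative
(`isHodgeMultiset_map_neg`) and `s + (-σ)` (a Hodge 12-multiset). The four progression points `F₄ ⊂ s` are
pairwise distinct (the progression is the fibre of reduction mod `m/5`, `range_map_eq_filter_of_dvd_one`), so
`s = F₄ + {u₁, u₂}` and `s + (-σ) = (F₄ + (-F₄)) + {u₁, u₂, -(A + j₀ e), 5A}`; cancelling the pairs
(`isHodgeMultiset_add_map_neg`, `IsHodgeMultiset.of_add_left`) leaves a Hodge QUADRUPLE, which by the surface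
theorem of Aoki–Shioda 1983 (`(𝔅²ₘ) (i)`, `(m, 6) = 1`, DISCHARGED in the tree:
`AokiShioda1983_thmB2m_coprime_six_holds`) splits into two pairs (`exists_pairing_of_four`). If `-(A + j₀ e)`
pairs with `5A` then `5A = A + j₀ e`, so `20A = 5 j₀ e = 0` and `5A = 0` (`4` is a unit mod the odd `m`) —
excluded; otherwise `{u₁, u₂} = {A + j₀ e, -5A}` and `s = σ`.

References: [AokiShioda1983] N. Aoki, T. Shioda, Generators of the Néron–Severi group of a Fermat surface,
Progr. Math. 35 (1983), §2 Theorem (𝔅²ₘ) (i); [Aoki1983] N. Aoki, Math. Ann. 266 (1983) §5 Prop. 5.1, §7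
Thm. A′; [Aoki1987] N. Aoki, J. Math. Soc. Japan 39 (1987) §1 p. 387; [Shioda1979PJA] T. Shioda, Proc. Japan
Acad. 55A (1979) §1.
-/

set_option linter.dupNamespace false

noncomputable section

open Finset
open Literature.AlgebraicGeometry.HodgeTheory Literature.AlgebraicGeometry.HodgeTheory.FermatCharacter

namespace Summit.HodgeConjecture.HodgeConjecture.Theorems.CancelByAnyClaimLattice.CoprimeSix

/-! ### Bookkeeping: negatives of Hodge multisets -/

/-- The negation `-s` of a Hodge multiset `s` is a Hodge multiset: `-a ≠ 0`, `Σ(-a) = 0`, and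
`⟨t · (-a)⟩ = ⟨(-t) · a⟩` with `-t` again a unit. [cite: Shioda1979PJA, §1 (definition of `Mₘ`)] -/
theorem isHodgeMultiset_map_neg {m : ℕ} {s : Multiset (ZMod m)} (hs : IsHodgeMultiset s) :
    IsHodgeMultiset (s.map fun a ↦ -a) := by
  -- adapted from `…PadicSemiregularLiftHodgeFermatVarietiesPrintedSupply` (private `isHodgeMultiset_map_neg`)
  refine ⟨⟨fun a ha ↦ ?_, ?_⟩, fun t ↦ ?_⟩
  · obtain ⟨b, hb, rfl⟩ := Multiset.mem_map.1 ha
    exact neg_ne_zero.2 (hs.1.1 b hb)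
  · rw [Multiset.sum_map_neg', hs.1.2, neg_zero]
  · have hf : ((fun a ↦ (t : ZMod m) * a) ∘ fun a ↦ -a) = fun a ↦ ((-t : (ZMod m)ˣ) : ZMod m) * a := by
      funext a
      simp [Units.val_neg]
    rw [Multiset.map_map, Multiset.card_map, hf]
    exact hs.2 (-t)

/-! ### The surface theorem on an explicit quadruple -/

/-- **Aoki–Shioda `(𝔅²ₘ) (i)` for an explicit quadruple.** At a level `m` coprime to `6`, a Hodge
multiset `{a, b, c, d}` splits into two pairs: `a + b = 0 = c + d`, or `a + c = 0 = b + d`, or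
`a + d = 0 = b + c` (realise it as the Hodge character `(a, b, c, d)` of the Fermat surface, take the
vanishing pair of `AokiShioda1983_thmB2m_coprime_six_holds`, and use `a + b + c + d = 0` for the other two).
[cite: AokiShioda1983, §2 Theorem (𝔅²ₘ) (i)] -/
theorem exists_pairing_of_four {m : ℕ} [NeZero m] (hm : m.Coprime 6) {a b c d : ZMod m}
    (h : IsHodgeMultiset ({a, b, c, d} : Multiset (ZMod m))) :
    (a + b = 0 ∧ c + d = 0) ∨ (a + c = 0 ∧ b + d = 0) ∨ (a + d = 0 ∧ b + c = 0) := by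
  have hsum := h.1.2
  simp only [Multiset.insert_eq_cons, Multiset.sum_cons, Multiset.sum_singleton] at hsum
  have huniv : (univ : Finset (Fin 4)).val.map ![a, b, c, d] = ({a, b, c, d} : Multiset (ZMod m)) := rfl
  have hα : IsHodge ![a, b, c, d] := by
    rw [isHodge_iff_isHodgeMultiset, huniv]
    exact h
  obtain ⟨i, j, hij, hz⟩ := AokiShioda1983_thmB2m_coprime_six_holds m hm _ hα
  fin_cases i <;> fin_cases j <;> simp at hij hz
  all_goals first
    | exact Or.inl ⟨by linear_combination hz, by linear_combination hsum - hz⟩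
    | exact Or.inl ⟨by linear_combination hsum - hz, by linear_combination hz⟩
    | exact Or.inr (Or.inl ⟨by linear_combination hz, by linear_combination hsum - hz⟩)
    | exact Or.inr (Or.inl ⟨by linear_combination hsum - hz, by linear_combination hz⟩)
    | exact Or.inr (Or.inr ⟨by linear_combination hz, by linear_combination hsum - hz⟩)
    | exact Or.inr (Or.inr ⟨by linear_combination hsum - hz, by linear_combination hz⟩)

/-! ### The core: four progression points force `σ_{5,A}` -/

/-- **Four points of a `5`-progression force `σ_{5,A}`, abstract form.** Let `s` be a Hodge sextuple of
level `m` coprime to `6`, `A, e ∈ ℤ/m` with `5A ≠ 0`, `5e = 0`, such that the progression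
`{A + i e : i < 5}` has no repetition and `σ = {A + i e : i < 5} + {-5A}` is a Hodge multiset. If
`A + j e ∈ s` for all `j < 5`, `j ≠ j₀`, then `s = σ`: `s + (-σ)` minus the four pairs `{A + je, -(A + je)}`
is a Hodge quadruple `{u₁, u₂, -(A + j₀ e), 5A}`, two pairs by Aoki–Shioda; `5A = A + j₀ e` would give
`20 A = 0`, so `{u₁, u₂} = {A + j₀ e, -5A}`. [cite: Aoki1983, §5 Prop. 5.1 and §7 Thm. A′]
[cite: AokiShioda1983, §2 Theorem (𝔅²ₘ) (i)] -/
theorem eq_sigmaFive_of_fibre {m : ℕ} [NeZero m] (hm : m.Coprime 6) {s : Multiset (ZMod m)}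
    (hs : IsHodgeMultiset s) (h6 : Multiset.card s = 6) {A e : ZMod m} (hA : (5 : ZMod m) * A ≠ 0)
    (he5 : (5 : ZMod m) * e = 0)
    (hσ : IsHodgeMultiset ((Multiset.range 5).map (fun i : ℕ ↦ A + (i : ZMod m) * e) + {-((5 : ZMod m) * A)}))
    (hnd : ((Multiset.range 5).map (fun i : ℕ ↦ A + (i : ZMod m) * e)).Nodup)
    {j₀ : ℕ} (hj₀ : j₀ < 5) (hfib : ∀ j : ℕ, j < 5 → j ≠ j₀ → A + (j : ZMod m) * e ∈ s) :
    s = (Multiset.range 5).map (fun i : ℕ ↦ A + (i : ZMod m) * e) + {-((5 : ZMod m) * A)} := by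
  classical
  set f : ℕ → ZMod m := fun i ↦ A + (i : ZMod m) * e with hf
  have hfj : f j₀ = A + (j₀ : ZMod m) * e := by rw [hf]
  -- the four progression points lying in `s`
  set F₄ : Multiset (ZMod m) := ((Finset.range 5).erase j₀).val.map f with hF₄
  have hsplit : (Multiset.range 5).map f = f j₀ ::ₘ F₄ := by
    rw [hF₄, ← Multiset.map_cons f j₀, ← Finset.insert_val_of_notMem (Finset.notMem_erase j₀ _),
      Finset.insert_erase (Finset.mem_range.mpr hj₀), Finset.range_val]
  have hF₄nd : F₄.Nodup := by
    refine Multiset.nodup_of_le ?_ hnd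
    rw [hsplit]
    exact Multiset.le_cons_self _ _
  have hF₄s : F₄ ≤ s := by
    refine (Multiset.le_iff_subset hF₄nd).mpr fun x hx ↦ ?_
    obtain ⟨j, hj, rfl⟩ := Multiset.mem_map.mp hx
    rw [Finset.mem_val, Finset.mem_erase, Finset.mem_range] at hj
    exact hfib j hj.2 hj.1
  obtain ⟨u, hsu⟩ := Multiset.le_iff_exists_add.mp hF₄s
  have hF₄card : Multiset.card F₄ = 4 := by
    rw [hF₄, Multiset.card_map, Finset.card_val, Finset.card_erase_of_mem (Finset.mem_range.mpr hj₀),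
      Finset.card_range]
  have hucard : Multiset.card u = 2 := by
    have hc := congrArg Multiset.card hsu
    rw [Multiset.card_add, hF₄card, h6] at hc
    omega
  obtain ⟨u₁, u₂, rfl⟩ := Multiset.card_eq_two.mp hucard
  -- the Hodge quadruple `{u₁, u₂, -(f j₀), 5A}`
  have hF₄0 : ∀ x ∈ F₄, x ≠ 0 := fun x hx ↦ hs.1.1 x (Multiset.mem_of_le hF₄s hx)
  have hpairs : IsHodgeMultiset (F₄ + F₄.map (fun a ↦ -a)) := isHodgeMultiset_add_map_neg hF₄0
  have hbig : IsHodgeMultiset (s + ((Multiset.range 5).map f + {-((5 : ZMod m) * A)}).map (fun a ↦ -a)) :=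
    hs.add (isHodgeMultiset_map_neg hσ)
  have heq : s + ((Multiset.range 5).map f + {-((5 : ZMod m) * A)}).map (fun a ↦ -a) =
      (F₄ + F₄.map (fun a ↦ -a)) + {u₁, u₂, -(f j₀), 5 * A} := by
    rw [hsu, hsplit]
    simp only [Multiset.map_add, Multiset.map_singleton, neg_neg, Multiset.insert_eq_cons,
      ← Multiset.singleton_add]
    abel
  rw [heq] at hbig
  have ht : IsHodgeMultiset ({u₁, u₂, -(f j₀), 5 * A} : Multiset (ZMod m)) := hbig.of_add_left hpairs
  -- the obstruction: `5A = A + j₀ e` is impossible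
  have hbad : -(f j₀) + 5 * A = 0 → False := by
    intro h
    have h2u : IsUnit ((2 : ℕ) : ZMod m) := by
      rw [ZMod.isUnit_iff_coprime]
      exact (Nat.Coprime.coprime_dvd_right (by norm_num) hm).symm
    have h20 : ((2 : ℕ) : ZMod m) * (((2 : ℕ) : ZMod m) * (5 * A)) = 0 := by
      push_cast
      linear_combination (5 : ZMod m) * h + (5 : ZMod m) * hfj + (j₀ : ZMod m) * he5
    rw [h2u.mul_right_eq_zero, h2u.mul_right_eq_zero] at h20
    exact hA h20
  -- the conclusion, once `{u₁, u₂} = {f j₀, -5A}`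
  have hgoal : ({u₁, u₂} : Multiset (ZMod m)) = {f j₀, -(5 * A)} →
      F₄ + {u₁, u₂} = (Multiset.range 5).map f + {-(5 * A)} := by
    intro h
    rw [h, hsplit, Multiset.insert_eq_cons, Multiset.add_cons, Multiset.cons_add]
  rcases exists_pairing_of_four hm ht with ⟨-, h2⟩ | ⟨h1, h2⟩ | ⟨h1, h2⟩
  · exact (hbad h2).elim
  · rw [hsu]
    apply hgoal
    rw [show u₁ = f j₀ by linear_combination h1, show u₂ = -(5 * A) by linear_combination h2]
  · rw [hsu]
    apply hgoal
    rw [show u₁ = -(5 * A) by linear_combination h1, show u₂ = f j₀ by linear_combination h2,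
      Multiset.pair_comm]

/-! ### The registered stub -/

/-- **S16-L3 `stub_sigmaFive_of_fibre` — four points of a `5`-progression force `σ_{5,A}`.** If a Hodge
sextuple `s` of level `m` coprime to `6`, `5 ∣ m`, contains all but one of the five points `A + j(m/5)`
(`5A ≠ 0`), then `s` is three pairs or `s = {A + j(m/5) : j < 5} + {-5A}`: the standard multiset
`σ_{5,A}` is Hodge (`isHodgeMultiset_pStandard`, `p = 5 = 2·2+1`), the progression is the fibre of reduction
mod `m/5` (no repetition), `5 · (m/5) = 0`, and `eq_sigmaFive_of_fibre` applies.
[cite: AokiShioda1983, §2 Theorem (𝔅²ₘ) (i)] [cite: Aoki1987, §1 p. 387] -/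
theorem stub_sigmaFive_of_fibre :
    ∀ (m : ℕ) [NeZero m], m.Coprime 6 → 5 ∣ m →
      ∀ s : Multiset (ZMod m), IsHodgeMultiset s → Multiset.card s = 6 →
      ∀ A : ZMod m, (5 : ZMod m) * A ≠ 0 →
        (∃ j₀ : ℕ, j₀ < 5 ∧ ∀ j : ℕ, j < 5 → j ≠ j₀ → A + (j : ZMod m) * ((m / 5 : ℕ) : ZMod m) ∈ s) →
        (∃ Q : Multiset (ZMod m), (∀ a ∈ Q, a ≠ 0) ∧ s = Q + Q.map (fun a ↦ -a)) ∨
        s = (Multiset.range 5).map (fun i : ℕ ↦ A + (i : ZMod m) * ((m / 5 : ℕ) : ZMod m)) +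
          {-((5 : ZMod m) * A)} := by
  intro m _ hm h5 s hs h6 A hA hfib
  obtain ⟨j₀, hj₀, hfib⟩ := hfib
  right
  have he5 : (5 : ZMod m) * ((m / 5 : ℕ) : ZMod m) = 0 := by
    have h : ((5 : ℕ) : ZMod m) * ((m / 5 : ℕ) : ZMod m) = 0 := by
      rw [← Nat.cast_mul, Nat.mul_div_cancel' h5, ZMod.natCast_self]
    simpa only [Nat.cast_ofNat] using h
  have hσ : IsHodgeMultiset ((Multiset.range 5).map (fun i : ℕ ↦ A + (i : ZMod m) * ((m / 5 : ℕ) : ZMod m)) +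
      {-((5 : ZMod m) * A)}) := by
    have h := isHodgeMultiset_pStandard (m := m) (p := 5) (r := 2) rfl h5 (a := A) (by exact_mod_cast hA)
    simpa only [Nat.cast_ofNat] using h
  have hnd : ((Multiset.range 5).map (fun i : ℕ ↦ A + (i : ZMod m) * ((m / 5 : ℕ) : ZMod m))).Nodup := by
    rw [range_map_eq_filter_of_dvd_one h5 A]
    exact Finset.nodup _
  exact eq_sigmaFive_of_fibre hm hs h6 hA he5 hσ hnd hj₀ hfib

end Summit.HodgeConjecture.HodgeConjecture.Theorems.CancelByAnyClaimLattice.CoprimeSix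

end
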